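import Summits.BirchSwinnertonDyer.BirchSwinnertonDyer.Theorems.GoldfeldAllTwistsTwoConverseTwinAdditiveTwoPrimesTwistSelmerPOne
import HarnessLib

set_option linter.dupNamespace false -- namespace `…BirchSwinnertonDyer.BirchSwinnertonDyer…` is the cell's (D-0017 nested layout)
set_option autoImplicit false

/-!
# Twin″ (item 19140), cell C7, TRANCHE C7-3 file F9b: the dual Selmer order `#S′ = #S(84qp, −28q²p²) ≤ 4` for `49a1^{(−2qp)}`,
# `S′ ⊆ {1, −7, −qp, 7qp}`

Cell `bsd-goldfeld`, seat `bsd-goldfeld-s1p-c3x` (gen 12); planner RULING (cccxxxviii) (3) «TRANCHE C7-3 (formula axis)», object F9, second file.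
`--supports stmt-BirchSwinnertonDyer-19140` as a HELPER. FACT-FREE: no print binder, no definition, no `sorry`.

THE CELL C7: `q ≡ 7 (mod 8)` prime, `(q/7) = −1`; `p ≡ 1 (mod 8)` prime, `(−7/p) = +1`, `−7` a fourth power mod `p` (β); `(p/q) = −1`. The 32
classes `d ∣ 14qp` of `S′` (quartic `d u⁴ + 84qp u²z² + d′ z⁴`, `d d′ = −28q²p²`) die as follows (kit/killtable and T3-D part 3):
* at `7` (sixteen classes, T3-D's `not_isSoluble_seven_dual` / `…_dual'`): `qp, 2qp, −7qp, −14qp, −p, −2p, 7p, 14p, q, 2q, −7q, −14q, −1, −2, 7, 14`;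
* at `p` by NON-RESIDUE (`(q/p) = −1`, `(2/p) = (7/p) = (−1/p) = +1`; part VIII's `not_isSoluble_padic_of_nonresidue_of_sq_dvd`): `−q, 7q, −2q, 14q`;
* at `p` by the TYPE-β ROOT TEST (T3-D's `not_isSoluble_padic_typeBeta_class_dual`, `x⁴ = −7`, `u² = 7` mod `p`): `p, −7p, 2p, −14p`
  (non-residues `14q, −2q, 7q, −q`);
* at `2` (file F9a, the numeric quartic `(−84; 2, −14)`): `2, −14, −2qp, 14qp`;
and `1, −7, −qp, 7qp` SURVIVE (`(#S, #S′) = (4, 4)` on C7; kit j312848/j313281: `S′ = {1, −7, −qp, 7qp}` on 70/70 rows). Versus T3-D (`p ≡ 5 (8)`):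
there `−qp, 7qp` died at `2`/at `p` and `−2q, 14q` survived.
HONEST FRAMING: a Selmer bound; no `BSD(W,2)` is proved; BSD is not proved by any of this; item 19140 stays open.

References: [SilvermanAEC2009] Prop. X.4.9, Example X.4.10; [Zywina2025] Lemma 3.1.
-/

noncomputable section

open scoped Classical

open WeierstrassCurve Literature.NumberTheory.EllipticCurves

namespace Summit.BirchSwinnertonDyer.BirchSwinnertonDyer.Theorems.GoldfeldGoodTwists

section SelmerDualPOne
variable {q p : ℕ} [Fact q.Prime] [Fact p.Prime]

/-- A natural number not divisible by the prime `ℓ` is non-zero in `ZMod ℓ`, as an integer cast. [folklore] -/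
private theorem intCast_ne_zero_of_not_dvd_dualPOne {l : ℕ} [Fact l.Prime] {n : ℕ} (h : ¬ l ∣ n) : ((n : ℤ) : ZMod l) ≠ 0 := by
  rw [Int.cast_natCast, Ne, ZMod.natCast_eq_zero_iff]; exact h

/-- A prime `ℓ ≠ 2, 7` divides no `2^a·7^b`. [folklore] -/
private theorem not_dvd_two_pow_mul_seven_pow_dualPOne {l : ℕ} (hl : l.Prime) (hl2 : l ≠ 2) (hl7 : l ≠ 7) (a b : ℕ) :
    ¬ l ∣ 2 ^ a * 7 ^ b := by
  intro h
  rcases (Nat.Prime.dvd_mul hl).mp h with h | h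
  · exact hl2 ((Nat.prime_dvd_prime_iff_eq hl Nat.prime_two).mp (hl.dvd_of_dvd_pow h))
  · exact hl7 ((Nat.prime_dvd_prime_iff_eq hl (by norm_num)).mp (hl.dvd_of_dvd_pow h))

omit [Fact q.Prime] [Fact p.Prime] in
/-- `7 ∤ a`, `7 ∤ b` ⇒ `7 ∤ ab`. [folklore] -/
private theorem not_seven_dvd_mul_dualPOne {a b : ℤ} (ha : ¬ (7 : ℤ) ∣ a) (hb : ¬ (7 : ℤ) ∣ b) : ¬ (7 : ℤ) ∣ a * b := fun h ↦
  ((Int.prime_iff_natAbs_prime.mpr (by norm_num) : Prime (7 : ℤ)).dvd_or_dvd h).elim ha hb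

/-- The C7 arithmetic facts used by both halves of the count. [folklore] -/
private theorem dual_facts_pOne (hq8 : q % 8 = 7) (hq7 : jacobiSym q 7 = -1) (hp8 : p % 8 = 1) (hp7 : legendreSym p (-7) = 1)
    (hpq : jacobiSym p q = -1) :
    (q ≠ p ∧ ¬ 7 ∣ q * p ∧ ¬ (7 : ℤ) ∣ q ∧ ¬ (7 : ℤ) ∣ p) ∧
    (legendreSym 7 q = -1 ∧ legendreSym 7 p = 1 ∧ ((q : ℤ) : ZMod 7) ≠ 0 ∧ ((p : ℤ) : ZMod 7) ≠ 0) ∧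
    (legendreSym p 2 = 1 ∧ legendreSym p 7 = 1 ∧ legendreSym p (-1) = 1 ∧ legendreSym p q = -1) ∧
    (((q : ℤ) : ZMod p) ≠ 0 ∧ ((2 : ℤ) : ZMod p) ≠ 0 ∧ ((28 : ℤ) : ZMod p) ≠ 0 ∧ (448 : ZMod p) ≠ 0 ∧ ((4 : ℤ) : ZMod p) ≠ 0) := by
  have hq : q.Prime := Fact.out
  have hp : p.Prime := Fact.out
  haveI : Fact (Nat.Prime 7) := ⟨by norm_num⟩
  have hq2 : q ≠ 2 := by rintro rfl; norm_num at hq8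
  have hp2 : p ≠ 2 := by rintro rfl; norm_num at hp8
  have hqp : q ≠ p := by rintro rfl; omega
  have hq7' : q ≠ 7 := by rintro rfl; rw [jacobiSym.mod_left] at hq7; norm_num at hq7
  have hp7' : p ≠ 7 := by rintro rfl; norm_num at hp8
  have h7Q : ¬ (7 : ℤ) ∣ q := fun h ↦ hq7' ((Nat.prime_dvd_prime_iff_eq (by norm_num) hq).mp (by exact_mod_cast h)).symm
  have h7P : ¬ (7 : ℤ) ∣ p := fun h ↦ hp7' ((Nat.prime_dvd_prime_iff_eq (by norm_num) hp).mp (by exact_mod_cast h)).symm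
  have h7qp : ¬ 7 ∣ q * p := fun h ↦ ((Nat.Prime.dvd_mul (by norm_num)).mp h).elim (fun h ↦ h7Q (by exact_mod_cast h))
    (fun h ↦ h7P (by exact_mod_cast h))
  obtain ⟨h2p, h7p, hm1p⟩ := legendreSym_two_seven_neg_one_of_one_mod_eight hp8 hp7
  obtain ⟨hqp_p, -⟩ := legendreSym_swap_of_one_mod_four (q := q) (p := p) (by omega) hqp hq2 hpq
  have h7_q : legendreSym 7 q = -1 := by rw [jacobiSym.legendreSym.to_jacobiSym]; exact_mod_cast hq7
  have h7_p : legendreSym 7 p = 1 := by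
    rw [legendreSym.quadratic_reciprocity_one_mod_four (by omega : p % 4 = 1) (by norm_num : 7 ≠ 2)]; exact h7p
  have hq07 : ((q : ℤ) : ZMod 7) ≠ 0 := by rw [Ne, ZMod.intCast_zmod_eq_zero_iff_dvd]; exact_mod_cast h7Q
  have hp07 : ((p : ℤ) : ZMod 7) ≠ 0 := by rw [Ne, ZMod.intCast_zmod_eq_zero_iff_dvd]; exact_mod_cast h7P
  have hqp0 : ((q : ℤ) : ZMod p) ≠ 0 :=
    intCast_ne_zero_of_not_dvd_dualPOne (l := p) (fun h ↦ hqp ((Nat.prime_dvd_prime_iff_eq hp hq).mp h).symm)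
  have hcp : ∀ a b : ℕ, (((2 ^ a * 7 ^ b : ℕ) : ℤ) : ZMod p) ≠ 0 := fun a b ↦
    intCast_ne_zero_of_not_dvd_dualPOne (not_dvd_two_pow_mul_seven_pow_dualPOne hp hp2 hp7' a b)
  have h2p0 : ((2 : ℤ) : ZMod p) ≠ 0 := by have := hcp 1 0; norm_num at this; exact_mod_cast this
  have h4p0 : ((4 : ℤ) : ZMod p) ≠ 0 := by have := hcp 2 0; norm_num at this; exact_mod_cast this
  have h28p0 : ((28 : ℤ) : ZMod p) ≠ 0 := by have := hcp 2 1; norm_num at this; exact_mod_cast this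
  have h448p : (448 : ZMod p) ≠ 0 := by have := hcp 6 1; norm_num at this; exact_mod_cast this
  exact ⟨⟨hqp, h7qp, h7Q, h7P⟩, ⟨h7_q, h7_p, hq07, hp07⟩, ⟨h2p, h7p, hm1p, hqp_p⟩, ⟨hqp0, h2p0, h28p0, h448p, h4p0⟩⟩

set_option maxHeartbeats 400000 in -- sixteen `p`-classes
/-- **§1. The classes of `S′ = S(84qp, −28q²p²)` divisible by `p` on C7 are among `−qp, 7qp`**: writing `d = p·e`, the other fourteen
die — `qp, 2qp, −7qp, −14qp, −p, −2p, 7p, 14p` at `7`; `−2qp, 14qp` at `2` (F9a); `p, −7p, 2p, −14p` at `p` by the type-β root test.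
[cite: SilvermanAEC2009, Prop. X.4.9 and Example X.4.10] -/
theorem eq_or_eq_of_prime_dvd_of_mem_twoIsogenySelmerGroup'_twoPrimesTwist_pOne (hq8 : q % 8 = 7) (hq7 : jacobiSym q 7 = -1)
    (hp8 : p % 8 = 1) (hp7 : legendreSym p (-7) = 1) (hβ : ∃ x : ZMod p, x ^ 4 = -7) (hpq : jacobiSym p q = -1)
    {d d' e : ℤ} (hsqf : Squarefree d) (hdd' : -28 * ((q : ℤ) * p) ^ 2 = d * d')
    (hpadic : ∀ (l : ℕ) [Fact l.Prime], ((twoIsogenyQuartic (84 * ((q : ℤ) * p)) d d').map (Int.castRingHom ℚ_[l])).IsSoluble)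
    (hde : d = p * e) : e = (q : ℤ) * -1 ∨ e = (q : ℤ) * 7 := by
  have hq : q.Prime := Fact.out
  have hp : p.Prime := Fact.out
  haveI : Fact (Nat.Prime 7) := ⟨by norm_num⟩
  have hqZ : Prime (q : ℤ) := Nat.prime_iff_prime_int.mp hq
  have hq0 : (q : ℤ) ≠ 0 := by exact_mod_cast hq.ne_zero
  have hp0 : (p : ℤ) ≠ 0 := by exact_mod_cast hp.ne_zero
  obtain ⟨⟨hqp, h7qp, h7Q, h7P⟩, ⟨h7_q, h7_p, hq07, hp07⟩, ⟨h2p, h7p, hm1p, hqp_p⟩, ⟨hqp0, h2p0, h28p0, h448p, h4p0⟩⟩ :=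
    dual_facts_pOne hq8 hq7 hp8 hp7 hpq
  have hns_7q_p : ¬ IsSquare (((7 * q : ℤ)) : ZMod p) :=
    (legendreSym.eq_neg_one_iff p).mp (by rw [legendreSym.mul, h7p, hqp_p]; norm_num)
  have hns_negq_p : ¬ IsSquare ((((q : ℤ) * -1 : ℤ)) : ZMod p) :=
    (legendreSym.eq_neg_one_iff p).mp (by rw [legendreSym.mul, hqp_p, hm1p]; norm_num)
  have hns_14q_p : ¬ IsSquare (((14 * q : ℤ)) : ZMod p) :=
    (legendreSym.eq_neg_one_iff p).mp (by
      rw [show (14 * q : ℤ) = 2 * 7 * q by ring, legendreSym.mul, legendreSym.mul, h2p, h7p, hqp_p]; norm_num)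
  have hns_m2q_p : ¬ IsSquare (((-2 * q : ℤ)) : ZMod p) :=
    (legendreSym.eq_neg_one_iff p).mp (by
      rw [show (-2 * q : ℤ) = -1 * 2 * q by ring, legendreSym.mul, legendreSym.mul, hm1p, h2p, hqp_p]; norm_num)
  have h14p0 : ((14 : ℤ) : ZMod p) ≠ 0 := by
    intro h; apply hns_14q_p
    rw [show ((14 * q : ℤ) : ZMod p) = ((14 : ℤ) : ZMod p) * q by push_cast; ring, h, zero_mul]; exact IsSquare.zero
  have h2q0 : ((2 * q : ℤ) : ZMod p) ≠ 0 := by push_cast; exact mul_ne_zero (by exact_mod_cast h2p0) (by exact_mod_cast hqp0)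
  -- `u² = 7` and `x⁴ = −7` mod `p`
  obtain ⟨u, hu⟩ : ∃ u : ZMod p, u ^ 2 = 7 := by
    have h7p0 : ((7 : ℤ) : ZMod p) ≠ 0 := by
      intro h; apply h448p; rw [show (448 : ZMod p) = ((7 : ℤ) : ZMod p) * 64 by push_cast; norm_num, h, zero_mul]
    obtain ⟨u, hu⟩ := (legendreSym.eq_one_iff p h7p0).mp h7p
    exact ⟨u, by rw [sq, ← hu]; push_cast; ring⟩
  obtain ⟨x, hx⟩ := hβ
  subst hde
  have hd'e : e * d' = -28 * (q : ℤ) ^ 2 * p := mul_left_cancel₀ hp0 (by linear_combination (-1 : ℤ) * hdd')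
  have h0 : (p : ℤ) * e ∣ -28 * ((q : ℤ) * p) ^ 2 := ⟨d', hdd'⟩
  have h1 : (p : ℤ) * e ∣ (14 * ((q : ℤ) * p)) ^ 2 := h0.trans ⟨-7, by ring⟩
  have h14qp : (p : ℤ) * e ∣ 14 * ((q : ℤ) * p) := (hsqf.dvd_pow_iff_dvd (by norm_num)).mp h1
  have he14q : e ∣ 14 * (q : ℤ) := by
    have : (p : ℤ) * e ∣ (p : ℤ) * (14 * q) := by rw [show (p : ℤ) * (14 * q) = 14 * (q * p) by ring]; exact h14qp
    exact (mul_dvd_mul_iff_left hp0).mp this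
  by_cases hqe : (q : ℤ) ∣ e
  · obtain ⟨e₂, rfl⟩ := hqe
    have he14 : e₂ ∣ 14 := by
      have : (q : ℤ) * e₂ ∣ (q : ℤ) * 14 := by rw [mul_comm (q : ℤ) 14]; exact he14q
      exact (mul_dvd_mul_iff_left hq0).mp this
    have hd'e₂ : e₂ * d' = -28 * (q : ℤ) * p := mul_left_cancel₀ hq0 (by linear_combination hd'e)
    have hele : e₂ ≤ 14 := Int.le_of_dvd (by norm_num) he14
    have hege : -14 ≤ e₂ := by have := Int.le_of_dvd (by norm_num) ((Int.neg_dvd).mpr he14); linarith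
    -- at `7`: `qp`, `2qp` (test `d`), `−7qp`, `−14qp` (test `d′`)
    have hne1 : e₂ ≠ 1 := by
      rintro rfl; exact not_isSoluble_seven_dual h7qp hdd'.symm (not_seven_dvd_mul_dualPOne h7P (not_seven_dvd_mul_dualPOne h7Q (by decide)))
        (by rw [legendreSym.mul, legendreSym.mul, h7_p, h7_q]; norm_num) (hpadic 7)
    have hne2 : e₂ ≠ 2 := by
      rintro rfl; exact not_isSoluble_seven_dual h7qp hdd'.symm (not_seven_dvd_mul_dualPOne h7P (not_seven_dvd_mul_dualPOne h7Q (by decide)))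
        (by rw [legendreSym.mul, legendreSym.mul, h7_p, h7_q]; norm_num) (hpadic 7)
    have hnem7 : e₂ ≠ -7 := by
      rintro rfl
      have hd'1 : d' = 4 * ((q : ℤ) * p) := mul_left_cancel₀ (by norm_num : (-7 : ℤ) ≠ 0) (by linear_combination hd'e₂)
      refine not_isSoluble_seven_dual' h7qp hdd'.symm ?_ ?_ (hpadic 7)
      · rw [hd'1]; exact not_seven_dvd_mul_dualPOne (by decide) (not_seven_dvd_mul_dualPOne h7Q h7P)
      · rw [hd'1, legendreSym.mul, legendreSym.mul, h7_q, h7_p]; norm_num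
    have hnem14 : e₂ ≠ -14 := by
      rintro rfl
      have hd'1 : d' = 2 * ((q : ℤ) * p) := mul_left_cancel₀ (by norm_num : (-14 : ℤ) ≠ 0) (by linear_combination hd'e₂)
      refine not_isSoluble_seven_dual' h7qp hdd'.symm ?_ ?_ (hpadic 7)
      · rw [hd'1]; exact not_seven_dvd_mul_dualPOne (by decide) (not_seven_dvd_mul_dualPOne h7Q h7P)
      · rw [hd'1, legendreSym.mul, legendreSym.mul, h7_q, h7_p]; norm_num
    -- at `2` (F9a): `−2qp`, `14qp`
    have hnem2 : e₂ ≠ -2 := by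
      rintro rfl; exact not_isSoluble_two_dual_negTwoQP_pOne hq8 hp8 rfl (by ring)
        (mul_left_cancel₀ (by norm_num : (-2 : ℤ) ≠ 0) (by linear_combination hd'e₂)) (hpadic 2)
    have hne14 : e₂ ≠ 14 := by
      rintro rfl; exact not_isSoluble_two_dual_fourteenQP_pOne hq8 hp8 rfl (by ring)
        (mul_left_cancel₀ (by norm_num : (14 : ℤ) ≠ 0) (by linear_combination hd'e₂)) (hpadic 2)
    -- `−qp`, `7qp` survive
    obtain ⟨k, hk⟩ := he14
    interval_cases e₂ <;> first | (exfalso; omega) | simp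
  · -- `q ∤ e`: `e ∣ 14`, all eight die
    exfalso
    have hcop : IsCoprime e (q : ℤ) := ((hqZ.irreducible.coprime_iff_not_dvd).mpr hqe).symm
    have he14 : e ∣ 14 := hcop.dvd_of_dvd_mul_left (by rw [mul_comm]; exact he14q)
    have hele : e ≤ 14 := Int.le_of_dvd (by norm_num) he14
    have hege : -14 ≤ e := by have := Int.le_of_dvd (by norm_num) ((Int.neg_dvd).mpr he14); linarith
    -- at `7`: `−p`, `−2p` (test `d`), `7p`, `14p` (test `d′`)
    have hnem1 : e ≠ -1 := by
      rintro rfl; exact not_isSoluble_seven_dual h7qp hdd'.symm (not_seven_dvd_mul_dualPOne h7P (by decide))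
        (by rw [legendreSym.mul, h7_p]; norm_num) (hpadic 7)
    have hnem2 : e ≠ -2 := by
      rintro rfl; exact not_isSoluble_seven_dual h7qp hdd'.symm (not_seven_dvd_mul_dualPOne h7P (by decide))
        (by rw [legendreSym.mul, h7_p]; norm_num) (hpadic 7)
    have hne7 : e ≠ 7 := by
      rintro rfl
      have hd'1 : d' = -4 * ((q : ℤ) ^ 2 * p) := mul_left_cancel₀ (by norm_num : (7 : ℤ) ≠ 0) (by linear_combination hd'e)
      refine not_isSoluble_seven_dual' h7qp hdd'.symm ?_ ?_ (hpadic 7)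
      · rw [hd'1]
        exact not_seven_dvd_mul_dualPOne (by decide) (not_seven_dvd_mul_dualPOne (by rw [sq]; exact not_seven_dvd_mul_dualPOne h7Q h7Q) h7P)
      · rw [hd'1, legendreSym.mul, legendreSym.mul, legendreSym.sq_one' 7 hq07, h7_p]; norm_num
    have hne14 : e ≠ 14 := by
      rintro rfl
      have hd'1 : d' = -2 * ((q : ℤ) ^ 2 * p) := mul_left_cancel₀ (by norm_num : (14 : ℤ) ≠ 0) (by linear_combination hd'e)
      refine not_isSoluble_seven_dual' h7qp hdd'.symm ?_ ?_ (hpadic 7)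
      · rw [hd'1]
        exact not_seven_dvd_mul_dualPOne (by decide) (not_seven_dvd_mul_dualPOne (by rw [sq]; exact not_seven_dvd_mul_dualPOne h7Q h7Q) h7P)
      · rw [hd'1, legendreSym.mul, legendreSym.mul, legendreSym.sq_one' 7 hq07, h7_p]; norm_num
    -- at `p` by the type-β root test: `p`, `−7p`, `2p`, `−14p`
    have hne1 : e ≠ 1 := by
      rintro rfl
      have hd'1 : d' = p * (-28 * q ^ 2) := by linear_combination hd'e
      refine not_isSoluble_padic_typeBeta_class_dual (q := q) h448p hx hu (e₀ := 1) (e'₀ := -28 * q ^ 2) (by ring)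
        (by push_cast; exact mul_ne_zero (neg_ne_zero.mpr (by exact_mod_cast h28p0)) (pow_ne_zero 2 (by exact_mod_cast hqp0))) ?_
        (by ring) hd'1 (hpadic p)
      rw [show (-2 : ZMod p) * (q : ZMod p) * ((-28 * q ^ 2 : ℤ) : ZMod p) = (((14 * q * (2 * q) ^ 2 : ℤ)) : ZMod p) by
        push_cast; ring]
      exact not_isSquare_mul_sq_zmod h2q0 hns_14q_p
    have hnem7 : e ≠ -7 := by
      rintro rfl
      have hd'1 : d' = p * (4 * q ^ 2) := mul_left_cancel₀ (by norm_num : (-7 : ℤ) ≠ 0) (by linear_combination hd'e)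
      refine not_isSoluble_padic_typeBeta_class_dual (q := q) h448p hx hu (e₀ := -7) (e'₀ := 4 * q ^ 2) (by ring)
        (by push_cast; exact mul_ne_zero (by exact_mod_cast h4p0) (pow_ne_zero 2 (by exact_mod_cast hqp0))) ?_ (by ring) hd'1 (hpadic p)
      rw [show (-2 : ZMod p) * (q : ZMod p) * ((4 * q ^ 2 : ℤ) : ZMod p) = (((-2 * q * (2 * q) ^ 2 : ℤ)) : ZMod p) by
        push_cast; ring]
      exact not_isSquare_mul_sq_zmod h2q0 hns_m2q_p
    have hne2 : e ≠ 2 := by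
      rintro rfl
      have hd'1 : d' = p * (-14 * q ^ 2) := mul_left_cancel₀ (by norm_num : (2 : ℤ) ≠ 0) (by linear_combination hd'e)
      refine not_isSoluble_padic_typeBeta_class_dual (q := q) h448p hx hu (e₀ := 2) (e'₀ := -14 * q ^ 2) (by ring)
        (by push_cast at h14p0 hqp0 ⊢; exact mul_ne_zero (neg_ne_zero.mpr h14p0) (pow_ne_zero 2 hqp0)) ?_ (by ring) hd'1 (hpadic p)
      rw [show (-2 : ZMod p) * (q : ZMod p) * ((-14 * q ^ 2 : ℤ) : ZMod p) = (((7 * q * (2 * q) ^ 2 : ℤ)) : ZMod p) by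
        push_cast; ring]
      exact not_isSquare_mul_sq_zmod h2q0 hns_7q_p
    have hnem14 : e ≠ -14 := by
      rintro rfl
      have hd'1 : d' = p * (2 * q ^ 2) := mul_left_cancel₀ (by norm_num : (-14 : ℤ) ≠ 0) (by linear_combination hd'e)
      refine not_isSoluble_padic_typeBeta_class_dual (q := q) h448p hx hu (e₀ := -14) (e'₀ := 2 * q ^ 2) (by ring)
        (by push_cast; exact mul_ne_zero (by exact_mod_cast h2p0) (pow_ne_zero 2 (by exact_mod_cast hqp0))) ?_ (by ring) hd'1
        (hpadic p)
      rw [show (-2 : ZMod p) * (q : ZMod p) * ((2 * q ^ 2 : ℤ) : ZMod p) = ((((q : ℤ) * -1 * (2 * q) ^ 2 : ℤ)) : ZMod p) by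
        push_cast; ring]
      exact not_isSquare_mul_sq_zmod h2q0 hns_negq_p
    obtain ⟨k, hk⟩ := he14
    interval_cases e <;> omega

set_option maxHeartbeats 400000 in -- sixteen classes prime to `p`
/-- **§2. `S′ = S(84qp, −28q²p²) ⊆ {1, −7, −qp, 7qp}` on C7.** [cite: SilvermanAEC2009, Prop. X.4.9 and Example X.4.10]
[cite: Zywina2025, Lemma 3.1 (proof)] -/
theorem twoIsogenySelmerGroup'_twoPrimesTwist_subset_pOne (hq8 : q % 8 = 7) (hq7 : jacobiSym q 7 = -1) (hp8 : p % 8 = 1)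
    (hp7 : legendreSym p (-7) = 1) (hβ : ∃ x : ZMod p, x ^ 4 = -7) (hpq : jacobiSym p q = -1) :
    twoIsogenySelmerGroup' (-42 * ((q : ℤ) * p)) (448 * ((q : ℤ) * p) ^ 2) ⊆
      ({1, -7, -((q : ℤ) * p), 7 * ((q : ℤ) * p)} : Finset ℤ) := by
  have hq : q.Prime := Fact.out
  have hp : p.Prime := Fact.out
  haveI : Fact (Nat.Prime 7) := ⟨by norm_num⟩
  have hqZ : Prime (q : ℤ) := Nat.prime_iff_prime_int.mp hq
  have hpZ : Prime (p : ℤ) := Nat.prime_iff_prime_int.mp hp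
  have hq0 : (q : ℤ) ≠ 0 := by exact_mod_cast hq.ne_zero
  have hp0 : (p : ℤ) ≠ 0 := by exact_mod_cast hp.ne_zero
  obtain ⟨⟨-, h7qp, h7Q, h7P⟩, ⟨h7_q, h7_p, hq07, hp07⟩, ⟨h2p, h7p, hm1p, hqp_p⟩, ⟨hqp0, h2p0, -, -, -⟩⟩ :=
    dual_facts_pOne hq8 hq7 hp8 hp7 hpq
  have hns_q7_p : ¬ IsSquare ((((q : ℤ) * 7 : ℤ)) : ZMod p) :=
    (legendreSym.eq_neg_one_iff p).mp (by rw [legendreSym.mul, h7p, hqp_p]; norm_num)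
  have hns_negq_p : ¬ IsSquare ((((q : ℤ) * -1 : ℤ)) : ZMod p) :=
    (legendreSym.eq_neg_one_iff p).mp (by rw [legendreSym.mul, hqp_p, hm1p]; norm_num)
  have hns_qm2_p : ¬ IsSquare ((((q : ℤ) * -2 : ℤ)) : ZMod p) :=
    (legendreSym.eq_neg_one_iff p).mp (by
      rw [show ((q : ℤ) * -2 : ℤ) = q * -1 * 2 by ring, legendreSym.mul, legendreSym.mul, hqp_p, hm1p, h2p]; norm_num)
  have hns_q14_p : ¬ IsSquare ((((q : ℤ) * 14 : ℤ)) : ZMod p) :=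
    (legendreSym.eq_neg_one_iff p).mp (by
      rw [show ((q : ℤ) * 14 : ℤ) = q * 2 * 7 by ring, legendreSym.mul, legendreSym.mul, hqp_p, h2p, h7p]; norm_num)
  have hns_28q_p : ¬ IsSquare (((28 * q : ℤ)) : ZMod p) := by
    rw [show (28 * q : ℤ) = q * 7 * 2 ^ 2 by ring]; exact not_isSquare_mul_sq_zmod h2p0 hns_q7_p
  have hns_m4q_p : ¬ IsSquare (((-4 * q : ℤ)) : ZMod p) := by
    rw [show (-4 * q : ℤ) = q * -1 * 2 ^ 2 by ring]; exact not_isSquare_mul_sq_zmod h2p0 hns_negq_p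
  have hns_14q_p : ¬ IsSquare (((14 * q : ℤ)) : ZMod p) := by rw [show (14 * q : ℤ) = q * 14 by ring]; exact hns_q14_p
  have hns_m2q_p : ¬ IsSquare (((-2 * q : ℤ)) : ZMod p) := by rw [show (-2 * q : ℤ) = q * -2 by ring]; exact hns_qm2_p
  have hA : (-2 * (-42 * ((q : ℤ) * p))) = 84 * ((q : ℤ) * p) := by ring
  have hB : ((-42 * ((q : ℤ) * p)) ^ 2 - 4 * (448 * ((q : ℤ) * p) ^ 2)) = -28 * ((q : ℤ) * p) ^ 2 := by ring
  have hb : (-28 * ((q : ℤ) * p) ^ 2 : ℤ) ≠ 0 := mul_ne_zero (by norm_num) (pow_ne_zero 2 (mul_ne_zero hq0 hp0))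
  intro d hd
  rw [twoIsogenySelmerGroup'_eq, hA, hB, mem_twoIsogenySelmerGroup_iff hb] at hd
  obtain ⟨hsqf, ⟨d', hdd'⟩, hloc⟩ := hd
  have hd'eq : (-28 * ((q : ℤ) * p) ^ 2 : ℤ) / d = d' := by rw [hdd', Int.mul_ediv_cancel_left _ hsqf.ne_zero]
  rw [hd'eq] at hloc
  obtain ⟨-, hpadic⟩ := hloc
  simp only [Finset.mem_insert, Finset.mem_singleton]
  by_cases hpd : (p : ℤ) ∣ d
  · -- `p ∣ d`: `d ∈ {−qp, 7qp}` by §1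
    obtain ⟨e, rfl⟩ := hpd
    rcases eq_or_eq_of_prime_dvd_of_mem_twoIsogenySelmerGroup'_twoPrimesTwist_pOne hq8 hq7 hp8 hp7 hβ hpq hsqf hdd' hpadic rfl
      with rfl | rfl
    · exact Or.inr (Or.inr (Or.inl (by ring)))
    · exact Or.inr (Or.inr (Or.inr (by ring)))
  · have h0 : d ∣ -28 * ((q : ℤ) * p) ^ 2 := ⟨d', hdd'⟩
    have h1 : d ∣ (14 * ((q : ℤ) * p)) ^ 2 := h0.trans ⟨-7, by ring⟩
    have h14qp : d ∣ 14 * ((q : ℤ) * p) := (hsqf.dvd_pow_iff_dvd (by norm_num)).mp h1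
    have hcopp : IsCoprime d (p : ℤ) := ((hpZ.irreducible.coprime_iff_not_dvd).mpr hpd).symm
    have h14q : d ∣ 14 * (q : ℤ) := hcopp.dvd_of_dvd_mul_right (by rw [show 14 * (q : ℤ) * p = 14 * (q * p) by ring]; exact h14qp)
    by_cases hqd : (q : ℤ) ∣ d
    · -- `d = q·e`, `e ∣ 14`: all eight die
      exfalso
      obtain ⟨e, rfl⟩ := hqd
      have he14 : e ∣ 14 := by
        have : (q : ℤ) * e ∣ (q : ℤ) * 14 := by rw [mul_comm (q : ℤ) 14]; exact h14q
        exact (mul_dvd_mul_iff_left hq0).mp this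
      have hd'e : e * d' = -28 * (q : ℤ) * p ^ 2 := mul_left_cancel₀ hq0 (by linear_combination (-1 : ℤ) * hdd')
      have hele : e ≤ 14 := Int.le_of_dvd (by norm_num) he14
      have hege : -14 ≤ e := by have := Int.le_of_dvd (by norm_num) ((Int.neg_dvd).mpr he14); linarith
      -- at `7`: `q`, `2q` (test `d`), `−7q`, `−14q` (test `d′`)
      have hne1 : e ≠ 1 := by
        rintro rfl; exact not_isSoluble_seven_dual h7qp hdd'.symm (not_seven_dvd_mul_dualPOne h7Q (by decide))
          (by rw [legendreSym.mul, h7_q]; norm_num) (hpadic 7)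
      have hne2 : e ≠ 2 := by
        rintro rfl; exact not_isSoluble_seven_dual h7qp hdd'.symm (not_seven_dvd_mul_dualPOne h7Q (by decide))
          (by rw [legendreSym.mul, h7_q]; norm_num) (hpadic 7)
      have hnem7 : e ≠ -7 := by
        rintro rfl
        have hd'1 : d' = 4 * ((q : ℤ) * (p : ℤ) ^ 2) := mul_left_cancel₀ (by norm_num : (-7 : ℤ) ≠ 0) (by linear_combination hd'e)
        refine not_isSoluble_seven_dual' h7qp hdd'.symm ?_ ?_ (hpadic 7)
        · rw [hd'1]
          exact not_seven_dvd_mul_dualPOne (by decide) (not_seven_dvd_mul_dualPOne h7Q (by rw [sq]; exact not_seven_dvd_mul_dualPOne h7P h7P))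
        · rw [hd'1, legendreSym.mul, legendreSym.mul, legendreSym.sq_one' 7 hp07, h7_q]; norm_num
      have hnem14 : e ≠ -14 := by
        rintro rfl
        have hd'1 : d' = 2 * ((q : ℤ) * (p : ℤ) ^ 2) := mul_left_cancel₀ (by norm_num : (-14 : ℤ) ≠ 0) (by linear_combination hd'e)
        refine not_isSoluble_seven_dual' h7qp hdd'.symm ?_ ?_ (hpadic 7)
        · rw [hd'1]
          exact not_seven_dvd_mul_dualPOne (by decide) (not_seven_dvd_mul_dualPOne h7Q (by rw [sq]; exact not_seven_dvd_mul_dualPOne h7P h7P))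
        · rw [hd'1, legendreSym.mul, legendreSym.mul, legendreSym.sq_one' 7 hp07, h7_q]; norm_num
      -- at `p` by non-residue: `−q`, `7q`, `−2q`, `14q`
      have hnem1 : e ≠ -1 := by
        rintro rfl; exact not_isSoluble_padic_of_nonresidue_of_sq_dvd (p := p) (c := 84 * q) (e' := 28 * q) (by ring)
          (by linear_combination (-1 : ℤ) * hd'e) hns_negq_p hns_28q_p (hpadic p)
      have hne7 : e ≠ 7 := by
        rintro rfl; exact not_isSoluble_padic_of_nonresidue_of_sq_dvd (p := p) (c := 84 * q) (e' := -4 * q) (by ring)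
          (mul_left_cancel₀ (by norm_num : (7 : ℤ) ≠ 0) (by linear_combination hd'e)) hns_q7_p hns_m4q_p (hpadic p)
      have hnem2 : e ≠ -2 := by
        rintro rfl; exact not_isSoluble_padic_of_nonresidue_of_sq_dvd (p := p) (c := 84 * q) (e' := 14 * q) (by ring)
          (mul_left_cancel₀ (by norm_num : (-2 : ℤ) ≠ 0) (by linear_combination hd'e)) hns_qm2_p hns_14q_p (hpadic p)
      have hne14 : e ≠ 14 := by
        rintro rfl; exact not_isSoluble_padic_of_nonresidue_of_sq_dvd (p := p) (c := 84 * q) (e' := -2 * q) (by ring)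
          (mul_left_cancel₀ (by norm_num : (14 : ℤ) ≠ 0) (by linear_combination hd'e)) hns_q14_p hns_m2q_p (hpadic p)
      obtain ⟨k, hk⟩ := he14
      interval_cases e <;> omega
    · have hcop : IsCoprime d (q : ℤ) := ((hqZ.irreducible.coprime_iff_not_dvd).mpr hqd).symm
      have hd14 : d ∣ 14 := hcop.dvd_of_dvd_mul_right h14q
      have hle : d ≤ 14 := Int.le_of_dvd (by norm_num) hd14
      have hge : -14 ≤ d := by have := Int.le_of_dvd (by norm_num) ((Int.neg_dvd).mpr hd14); linarith
      -- at `7`: `−1`, `−2` (test `d`), `7`, `14` (test `d′`)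
      have hnm1 : d ≠ -1 := by
        rintro rfl; exact not_isSoluble_seven_dual h7qp hdd'.symm (by decide) (by norm_num) (hpadic 7)
      have hnm2 : d ≠ -2 := by
        rintro rfl; exact not_isSoluble_seven_dual h7qp hdd'.symm (by decide) (by norm_num) (hpadic 7)
      have h7QP : ¬ (7 : ℤ) ∣ ((q : ℤ) * p) ^ 2 := by
        rw [sq]; exact not_seven_dvd_mul_dualPOne (not_seven_dvd_mul_dualPOne h7Q h7P) (not_seven_dvd_mul_dualPOne h7Q h7P)
      have hQP07 : ((((q : ℤ) * p : ℤ)) : ZMod 7) ≠ 0 := by push_cast at hq07 hp07 ⊢; exact mul_ne_zero hq07 hp07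
      have hn7 : d ≠ 7 := by
        rintro rfl
        have hd'1 : d' = -4 * ((q : ℤ) * p) ^ 2 := by linarith
        refine not_isSoluble_seven_dual' h7qp hdd'.symm ?_ ?_ (hpadic 7)
        · rw [hd'1]; exact not_seven_dvd_mul_dualPOne (by decide) h7QP
        · rw [hd'1, legendreSym.mul, legendreSym.sq_one' 7 hQP07]; norm_num
      have hn14 : d ≠ 14 := by
        rintro rfl
        have hd'1 : d' = -2 * ((q : ℤ) * p) ^ 2 := by linarith
        refine not_isSoluble_seven_dual' h7qp hdd'.symm ?_ ?_ (hpadic 7)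
        · rw [hd'1]; exact not_seven_dvd_mul_dualPOne (by decide) h7QP
        · rw [hd'1, legendreSym.mul, legendreSym.sq_one' 7 hQP07]; norm_num
      -- at `2` (F9a): `2`, `−14`
      have hn2 : d ≠ 2 := by
        rintro rfl; exact not_isSoluble_two_dual_two_pOne hq8 hp8 rfl rfl (by linarith) (hpadic 2)
      have hnm14 : d ≠ -14 := by
        rintro rfl; exact not_isSoluble_two_dual_negFourteen_pOne hq8 hp8 rfl rfl (by linarith) (hpadic 2)
      -- `1`, `−7` survive
      obtain ⟨k, hk⟩ := hd14
      interval_cases d <;> first | (exfalso; omega) | simp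

/-- **`#S′ = #S(84qp, −28q²p²) ≤ 4` on C7** (sharp by the kit). [cite: SilvermanAEC2009, Prop. X.4.9 and Example X.4.10] -/
theorem card_twoIsogenySelmerGroup'_twoPrimesTwist_le_four_pOne (hq8 : q % 8 = 7) (hq7 : jacobiSym q 7 = -1) (hp8 : p % 8 = 1)
    (hp7 : legendreSym p (-7) = 1) (hβ : ∃ x : ZMod p, x ^ 4 = -7) (hpq : jacobiSym p q = -1) :
    (twoIsogenySelmerGroup' (-42 * ((q : ℤ) * p)) (448 * ((q : ℤ) * p) ^ 2)).card ≤ 4 :=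
  (Finset.card_le_card (twoIsogenySelmerGroup'_twoPrimesTwist_subset_pOne hq8 hq7 hp8 hp7 hβ hpq)).trans Finset.card_le_four

end SelmerDualPOne

end Summit.BirchSwinnertonDyer.BirchSwinnertonDyer.Theorems.GoldfeldGoodTwists

end
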